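import Summits.BirchSwinnertonDyer.BirchSwinnertonDyer.Theorems.CMKolyvaginAtInertTwoCMKolyvaginConjectureAtInertTwoPositiveDepthGenusTrace
import Summits.BirchSwinnertonDyer.BirchSwinnertonDyer.Theses.CMKolyvaginAtInertTwo
import HarnessLib

/-!
# Crux `CMKolyvaginConjectureAtInertTwo` (stmt-BirchSwinnertonDyer-24648) IS, BY NAME, THE GENUS-TRACE DICHOTOMY

Route `CMKolyvaginAtInertTwo` (cell `pub/bsd-eis`, seat `leafhand-bsd-cmkolyvaginatinert-1` g0); helper (`--supports
stmt-BirchSwinnertonDyer-24648 --as helper`). THEOREMS ONLY (no definition, no named fact, no `sorry`); closes nothing;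
BSD is proved for no curve. Capstone of p794939 / p795141 / p796080 / p796272 (same seat).

WHAT. `cmKolyvaginConjectureAtInertTwo_iff_genusTraceDichotomy`: the route decl
`Summit.…Theses.CMKolyvaginAtInertTwo.CMKolyvaginConjectureAtInertTwo` (Kolyvagin's conjecture at `2` on H₂, `∀ K`) is
EQUIVALENT to the following statement on the same frames (binders verbatim): EITHER `y_K = P(1) ∉ 2E(K[1])` (depth `0`),
OR some square-free product `n` of Zhang–Kolyvagin primes at `2` inert in `F` carries a Kolyvagin–Heegner datum `d` whose
GENUS TRACE `Σ_{s ∈ S} s(𝒩_n y(n))`, `𝒩_n = ∏_{ℓ ∣ n} Σ_{k < (ℓ+1)/2} σ_ℓ^{2k}` (norm to the genus `2`-layer of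
`K[n]/K[1]`), is not `2`-divisible in `E(K[n])`. Direction ⟸: depth `0` is the witness `n = 1`, `d := d₁` of the landed `stub_levelOne` (p605855; two lines, inlined);
positive depth is p795141's `two_dvd_derivedPoint_iff_two_dvd_genusTrace`. Direction ⟹: in positive depth a crux
witness `(n, d)` has a `2`-primitive genus trace (`genusTrace_primitive_of_derivedPoint_primitive`, any `n`). Also recorded:
`cmKolyvaginConjectureAtInertTwo_of_genusTraceDichotomy` / `genusTraceDichotomy_of_cmKolyvaginConjectureAtInertTwo`.

HONEST FRAMING: logic over landed theorems; the crux is NOT proved (nor refuted); its open content is displayed in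
genus-trace currency (cf. the genus Heegner points `tr_{H_M/H_0}` of the generalized Birch lemma, arXiv:2102.11808 §2,
and Tian's genus-field induction — there for quadratic-twist families, here for CM-inert Kolyvagin levels).
[cite: GrossLMS1991, §3 (3.5), Prop. 3.7 (1), §4 (4.1)] [cite: WZhang2014, §3.7, Notations (xii)]
-/

set_option linter.dupNamespace false -- `Summit.BirchSwinnertonDyer.BirchSwinnertonDyer.Theorems.…` (summit = sub)
set_option autoImplicit false

noncomputable section

open scoped Classical

namespace Summit.BirchSwinnertonDyer.BirchSwinnertonDyer.Theorems.CMKolyvaginConjecturePositiveDepth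

open Finset WeierstrassCurve NumberField
open Literature.NumberTheory.EllipticCurves Literature.NumberTheory.EllipticCurves.ModularForms
open Literature.NumberTheory.EllipticCurves.Rank1Residual
open Summit.BirchSwinnertonDyer.BirchSwinnertonDyer.Theorems
open Summit.BirchSwinnertonDyer.BirchSwinnertonDyer.Theses.CMKolyvaginAtInertTwo (CMKolyvaginConjectureAtInertTwo)

/-- **Crux 24648 ⟸ the genus-trace dichotomy** (depth `0`: `stub_levelOne`; positive depth: p795141).
[cite: GrossLMS1991, §4 (4.1)] -/
theorem cmKolyvaginConjectureAtInertTwo_of_genusTraceDichotomy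
    (h : ∀ (W : WeierstrassCurve ℚ) [W.IsElliptic] [W.IsGloballyMinimal] [NeZero (W.conductorNorm ℤ)], W.HasCM → Literature.NumberTheory.EllipticCurves.Rank1Residual.CMInert W 2 → W.HasSurjectiveModNGaloisRep (2 : ℤ) → W.analyticRank = 1 → Odd W.tamagawaProduct → ∀ (K : Type) [Field K] [NumberField K], Literature.NumberTheory.EllipticCurves.IsImaginaryQuadratic K → Odd (NumberField.discr K) → NumberField.discr K ≠ -3 → Literature.NumberTheory.EllipticCurves.SatisfiesHeegnerHypothesis (W.conductorNorm ℤ) K → ∀ (Dt : Literature.NumberTheory.EllipticCurves.ModularForms.ModularParametrizationData W (W.conductorNorm ℤ)), (∀ z ∈ Dt.L.lattice, ∃ w ∈ Literature.NumberTheory.EllipticCurves.ModularForms.periodLattice Dt.f, z = (Dt.c : ℂ) * w) → Odd Dt.c → ∀ (β : ℤ) (ι : K →+* ℂ) (d₁ : Literature.NumberTheory.EllipticCurves.KolyvaginHeegnerData Dt β ι 1), ¬ IsOfFinAddOrder d₁.derivedPoint →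
      (¬ ∃ Q : (W.baseChange (Literature.NumberTheory.EllipticCurves.ringClassField K ι 1)).toAffine.Point, (2 : ℤ) • Q = d₁.derivedPoint) ∨
      ∃ (n : ℕ) (d : Literature.NumberTheory.EllipticCurves.KolyvaginHeegnerData Dt β ι n), Squarefree n ∧
        (∀ ℓ ∈ n.primeFactors, (Literature.NumberTheory.EllipticCurves.Zhang2014.IsKolyvaginPrime (W.conductorNorm ℤ) W K 2 ℓ ∧
          Literature.NumberTheory.EllipticCurves.Rank1Residual.CMInert W ℓ)) ∧
        ¬ ∃ Q : (W.baseChange (Literature.NumberTheory.EllipticCurves.ringClassField K ι n)).toAffine.Point, (2 : ℤ) • Q =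
          ∑ s ∈ d.S, Literature.NumberTheory.EllipticCurves.pointGalHom W (Literature.NumberTheory.EllipticCurves.ringClassField K ι n) s
            (n.primeFactorsList.foldr
              (fun ℓ x ↦ ∑ k ∈ Finset.range ((ℓ + 1) / 2),
                Literature.NumberTheory.EllipticCurves.pointGalHom W (Literature.NumberTheory.EllipticCurves.ringClassField K ι n) ((d.σ ℓ ^ 2) ^ k) x) d.y)) :
    CMKolyvaginConjectureAtInertTwo := by
  intro W _ _ _ hCM hin hρ hr hT K _ _ hK hodd h3 hH Dt hDt hc β ι d₁ hy
  rcases h W hCM hin hρ hr hT K hK hodd h3 hH Dt hDt hc β ι d₁ hy with h0 | ⟨n, d, hn, hKol, hG⟩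
  · -- depth 0: the witness is `n = 1`, `d := d₁` (the landed `stub_levelOne`, p605855, inlined to stay route-independent)
    exact ⟨1, d₁, squarefree_one, fun ℓ hℓ ↦ absurd hℓ (by simp), h0⟩
  · exact ⟨n, d, hn, hKol, fun hP ↦ hG
      ((two_dvd_derivedPoint_iff_two_dvd_genusTrace W hCM hK hodd h3 hH hn hKol d).mp hP)⟩

/-- **Crux 24648 ⟹ the genus-trace dichotomy** (in positive depth the crux witness has a `2`-primitive genus trace).
[cite: GrossLMS1991, §4 (4.1)] -/
theorem genusTraceDichotomy_of_cmKolyvaginConjectureAtInertTwo (h : CMKolyvaginConjectureAtInertTwo) :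
    ∀ (W : WeierstrassCurve ℚ) [W.IsElliptic] [W.IsGloballyMinimal] [NeZero (W.conductorNorm ℤ)], W.HasCM → Literature.NumberTheory.EllipticCurves.Rank1Residual.CMInert W 2 → W.HasSurjectiveModNGaloisRep (2 : ℤ) → W.analyticRank = 1 → Odd W.tamagawaProduct → ∀ (K : Type) [Field K] [NumberField K], Literature.NumberTheory.EllipticCurves.IsImaginaryQuadratic K → Odd (NumberField.discr K) → NumberField.discr K ≠ -3 → Literature.NumberTheory.EllipticCurves.SatisfiesHeegnerHypothesis (W.conductorNorm ℤ) K → ∀ (Dt : Literature.NumberTheory.EllipticCurves.ModularForms.ModularParametrizationData W (W.conductorNorm ℤ)), (∀ z ∈ Dt.L.lattice, ∃ w ∈ Literature.NumberTheory.EllipticCurves.ModularForms.periodLattice Dt.f, z = (Dt.c : ℂ) * w) → Odd Dt.c → ∀ (β : ℤ) (ι : K →+* ℂ) (d₁ : Literature.NumberTheory.EllipticCurves.KolyvaginHeegnerData Dt β ι 1), ¬ IsOfFinAddOrder d₁.derivedPoint →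
      (¬ ∃ Q : (W.baseChange (Literature.NumberTheory.EllipticCurves.ringClassField K ι 1)).toAffine.Point, (2 : ℤ) • Q = d₁.derivedPoint) ∨
      ∃ (n : ℕ) (d : Literature.NumberTheory.EllipticCurves.KolyvaginHeegnerData Dt β ι n), Squarefree n ∧
        (∀ ℓ ∈ n.primeFactors, (Literature.NumberTheory.EllipticCurves.Zhang2014.IsKolyvaginPrime (W.conductorNorm ℤ) W K 2 ℓ ∧
          Literature.NumberTheory.EllipticCurves.Rank1Residual.CMInert W ℓ)) ∧
        ¬ ∃ Q : (W.baseChange (Literature.NumberTheory.EllipticCurves.ringClassField K ι n)).toAffine.Point, (2 : ℤ) • Q =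
          ∑ s ∈ d.S, Literature.NumberTheory.EllipticCurves.pointGalHom W (Literature.NumberTheory.EllipticCurves.ringClassField K ι n) s
            (n.primeFactorsList.foldr
              (fun ℓ x ↦ ∑ k ∈ Finset.range ((ℓ + 1) / 2),
                Literature.NumberTheory.EllipticCurves.pointGalHom W (Literature.NumberTheory.EllipticCurves.ringClassField K ι n) ((d.σ ℓ ^ 2) ^ k) x) d.y) := by
  intro W _ _ _ hCM hin hρ hr hT K _ _ hK hodd h3 hH Dt hDt hc β ι d₁ hy
  obtain ⟨n, d, hn, hKol, hP⟩ := h W hCM hin hρ hr hT K hK hodd h3 hH Dt hDt hc β ι d₁ hy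
  by_cases h2 : ∃ Q : (W.baseChange (ringClassField K ι 1)).toAffine.Point, (2 : ℤ) • Q = d₁.derivedPoint
  · exact Or.inr ⟨n, d, hn, hKol,
      genusTrace_primitive_of_derivedPoint_primitive W hCM hK hodd h3 hH hn hKol d hP⟩
  · exact Or.inl h2

/-- **Crux 24648 ⟺ the genus-trace dichotomy**, by name. [cite: GrossLMS1991, §3 (3.5), Prop. 3.7 (1), §4 (4.1)] -/
theorem cmKolyvaginConjectureAtInertTwo_iff_genusTraceDichotomy :
    CMKolyvaginConjectureAtInertTwo ↔
    ∀ (W : WeierstrassCurve ℚ) [W.IsElliptic] [W.IsGloballyMinimal] [NeZero (W.conductorNorm ℤ)], W.HasCM → Literature.NumberTheory.EllipticCurves.Rank1Residual.CMInert W 2 → W.HasSurjectiveModNGaloisRep (2 : ℤ) → W.analyticRank = 1 → Odd W.tamagawaProduct → ∀ (K : Type) [Field K] [NumberField K], Literature.NumberTheory.EllipticCurves.IsImaginaryQuadratic K → Odd (NumberField.discr K) → NumberField.discr K ≠ -3 → Literature.NumberTheory.EllipticCurves.SatisfiesHeegnerHypothesis (W.conductorNorm ℤ) K → ∀ (Dt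 : Literature.NumberTheory.EllipticCurves.ModularForms.ModularParametrizationData W (W.conductorNorm ℤ)), (∀ z ∈ Dt.L.lattice, ∃ w ∈ Literature.NumberTheory.EllipticCurves.ModularForms.periodLattice Dt.f, z = (Dt.c : ℂ) * w) → Odd Dt.c → ∀ (β : ℤ) (ι : K →+* ℂ) (d₁ : Literature.NumberTheory.EllipticCurves.KolyvaginHeegnerData Dt β ι 1), ¬ IsOfFinAddOrder d₁.derivedPoint →
      (¬ ∃ Q : (W.baseChange (Literature.NumberTheory.EllipticCurves.ringClassField K ι 1)).toAffine.Point, (2 : ℤ) • Q = d₁.derivedPoint) ∨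
      ∃ (n : ℕ) (d : Literature.NumberTheory.EllipticCurves.KolyvaginHeegnerData Dt β ι n), Squarefree n ∧
        (∀ ℓ ∈ n.primeFactors, (Literature.NumberTheory.EllipticCurves.Zhang2014.IsKolyvaginPrime (W.conductorNorm ℤ) W K 2 ℓ ∧
          Literature.NumberTheory.EllipticCurves.Rank1Residual.CMInert W ℓ)) ∧
        ¬ ∃ Q : (W.baseChange (Literature.NumberTheory.EllipticCurves.ringClassField K ι n)).toAffine.Point, (2 : ℤ) • Q =
          ∑ s ∈ d.S, Literature.NumberTheory.EllipticCurves.pointGalHom W (Literature.NumberTheory.EllipticCurves.ringClassField K ι n) s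
            (n.primeFactorsList.foldr
              (fun ℓ x ↦ ∑ k ∈ Finset.range ((ℓ + 1) / 2),
                Literature.NumberTheory.EllipticCurves.pointGalHom W (Literature.NumberTheory.EllipticCurves.ringClassField K ι n) ((d.σ ℓ ^ 2) ^ k) x) d.y) :=
  ⟨genusTraceDichotomy_of_cmKolyvaginConjectureAtInertTwo, cmKolyvaginConjectureAtInertTwo_of_genusTraceDichotomy⟩

end Summit.BirchSwinnertonDyer.BirchSwinnertonDyer.Theorems.CMKolyvaginConjecturePositiveDepth

end
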